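import Summits.CriticalPhenomena.PercolationContinuityZ3.Theorems.PercNearOneGluingNoHeavyLowerTailIncStarCutVertex
import Summits.CriticalPhenomena.PercolationContinuityZ3.Theorems.PercNearOneGluingNoHeavyLowerTailIncStarCycleEmbedded
import Summits.CriticalPhenomena.PercolationContinuityZ3.Theorems.PercNearOneGluingNoHeavyLowerTailSahiIndependentProducts
import HarnessLib

/-!
# Sahi positivity of EVERY ORDER for principal cluster events is a block property (cut-vertex composition)

Support file for the Sahi programme (`--supports stmt-CriticalPhenomena-4575`, prover prim-sahi-p2 gen 9).
No definitions, no named facts, no sorries; standard axioms.  Memo `…/prim-sahi-p2/PROOF-E3.md` §20.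

**Setting** (as in `…IncStarCutVertex.lean`).  A finite vertex type `V`, weights `w : Sym2 V → [0,1]`
(product Bernoulli bond percolation on all pairs), vertex sets `V₁, V₂` meeting exactly in the cut vertex `a`,
no pair of positive weight between `V₁ ∖ {a}` and `V₂ ∖ {a}`, a root `s ∈ V₁`.  The PRINCIPAL cluster events of
`(S, x)` are `{C_x ⊇ T in S} = ⋂_{t ∈ T} {x ↔_S t}` for finite target sets `T ⊆ S` (the empty target set gives
the sure event; a point target `{t}` gives `{x ↔_S t}`).

**Theorem `sahiE_principal_of_cutVertex`.**  If `E_m ≥ 0` for every `m` and every `m`-tuple of principal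
cluster events of `(V₁, s)`, and likewise for `(V₂, a)`, then `E_n ≥ 0` for every `n` and every `n`-tuple of
principal cluster events of `(V₁ ∪ V₂, s)` (`sahiE` of the indicator family under `bernoulliWeight w`).
So the class of rooted weighted graphs all of whose principal cluster events are Sahi-positive at every
order is closed under gluing at a cut vertex, and (induction along the block–cut tree) membership is decided
block by block.

**Proof.**  On configurations of positive weight (`…IncStarCutVertex`: `openConnIn_union_iff_of_mem_left/right`)
`{C_s ⊇ T} = {C^{V₁}_s ⊇ T ∩ V₁ (∪ {a} if T ⊄ V₁)} ∩ {C^{V₂}_a ⊇ T ∖ V₁} =: Φ_T ∩ Ψ_T`, the first factor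
determined by the pairs inside `V₁`, the second by the other pairs — independent under the product measure.
The INDEPENDENT PRODUCT FORMULA (`SahiIndependentProducts.sahiE_mul_nonneg_of_indepMoments`) expresses
`E_n(1_{Φ_i}1_{Ψ_i})` as a nonnegative combination of products of `E`'s of sub-families of the `1_{Ψ_i}`
(principal events of `(V₂, a)`) with `E`'s of families of PRODUCTS `∏_{i∈B} 1_{Φ_i} = 1_{C^{V₁}_s ⊇ ⋃_B T'_i}`
(again principal events of `(V₁, s)`), all nonnegative by hypothesis.  At order `3` with point targets this is
the cut-vertex theorem of gen 8 (`IncStarCutVertex.incStar_openConnIn_of_cutVertex`), whose series-composition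
lemmas are the `n = 3` instances of the product formula.
-/

noncomputable section

namespace Summit.CriticalPhenomena.PercolationContinuityZ3.Theorems

namespace SahiPrincipalCutVertex

open Finset MeasureTheory Literature.Combinatorics.Sahi2008 Literature.Probability.Percolation
  Literature.Probability.LatticeModels
open Literature.Probability.Percolation.DecisionTree (ind ind_of_mem ind_of_not_mem ind_nonneg)
open scoped Classical

variable {V : Type*}

/-! ### Plumbing -/

/-- Finite intersections of events determined by `K` are determined by `K`. [folklore] -/
private theorem determinedBy_biInter {ι β : Type*} {K : Set ι} (S : Finset β) (A : β → Set (Set ι))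
    (h : ∀ b ∈ S, DeterminedBy (A b) K) : DeterminedBy (⋂ b ∈ S, A b) K := by
  induction S using Finset.induction_on with
  | empty =>
    have : (⋂ b ∈ (∅ : Finset β), A b) = (Set.univ : Set (Set ι)) := by ext ω; simp
    rw [this]; exact determinedBy_univ K
  | insert b S hb ih =>
    rw [Finset.set_biInter_insert]
    exact DeterminedBy.inter (h b (mem_insert_self _ _)) (ih fun b' hb' => h b' (mem_insert_of_mem hb'))

/-- `E[1_A 1_B] = P(A ∩ B)` under the product Bernoulli weight (plumbing). [folklore] -/
private theorem ex_ind_mul_ind {ι : Type*} [Fintype ι] (p : ι → unitInterval) (A B : Set (Set ι)) :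
    ex (bernoulliWeight p) (ind A * ind B) = (prodBernoulli p).real (A ∩ B) := by
  rw [← ex_bernoulliWeight_ind]
  congr 1
  funext ω
  exact (BHK2006.ind_inter A B ω).symm

/-! ### The composition theorem at every order -/

variable [Fintype V]

/-- **Principal cluster events: Sahi positivity of every order passes through a cut vertex (relative form).**
Let `V₁ ∩ V₂ = {a}`, `s ∈ V₁`, and let `w` vanish on the pairs between `V₁ ∖ {a}` and `V₂ ∖ {a}`.  If
`E_m(1_{C_s ⊇ T_1 in V₁}, …, 1_{C_s ⊇ T_m in V₁}) ≥ 0` for all `m` and all finite `T_j ⊆ V₁`, and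
`E_m(1_{C_a ⊇ T_1 in V₂}, …) ≥ 0` for all `m` and all finite `T_j ⊆ V₂`, then
`E_n(1_{C_s ⊇ T_1 in V₁∪V₂}, …, 1_{C_s ⊇ T_n in V₁∪V₂}) ≥ 0` for all `n` and all finite `T_i ⊆ V₁ ∪ V₂`.
[this work] -/
theorem sahiE_principal_of_cutVertex (w : Sym2 V → unitInterval) {V₁ V₂ : Set V} {a s : V}
    (hV : ∀ x, x ∈ V₁ → x ∈ V₂ → x = a) (ha₁ : a ∈ V₁) (ha₂ : a ∈ V₂) (hs : s ∈ V₁)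
    (hw : ∀ x y : V, x ∈ V₁ → y ∈ V₂ → x ≠ a → y ≠ a → w s(x, y) = 0)
    (h₁ : ∀ (m : ℕ) (T : Fin m → Finset V), (∀ j, ∀ t ∈ T j, t ∈ V₁) →
      0 ≤ sahiE (bernoulliWeight w) m (fun j => ind (⋂ t ∈ T j, (openConnIn V₁ s t : Set (BondConfig V)))))
    (h₂ : ∀ (m : ℕ) (T : Fin m → Finset V), (∀ j, ∀ t ∈ T j, t ∈ V₂) →
      0 ≤ sahiE (bernoulliWeight w) m (fun j => ind (⋂ t ∈ T j, (openConnIn V₂ a t : Set (BondConfig V)))))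
    {n : ℕ} (T : Fin n → Finset V) (hT : ∀ i, ∀ t ∈ T i, t ∈ V₁ ∪ V₂) :
    0 ≤ sahiE (bernoulliWeight w) n
      (fun i => ind (⋂ t ∈ T i, (openConnIn (V₁ ∪ V₂) s t : Set (BondConfig V)))) := by
  -- near / far parts of the targets; the near part gains the cut vertex when the far part is inhabited
  let Tn : Fin n → Finset V := fun i => (T i).filter (fun t => t ∈ V₁)
  let Tf : Fin n → Finset V := fun i => (T i).filter (fun t => t ∉ V₁)
  let Tn' : Fin n → Finset V := fun i => if (Tf i).Nonempty then insert a (Tn i) else Tn i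
  let Φ : Fin n → Set (BondConfig V) := fun i => ⋂ t ∈ Tn' i, openConnIn V₁ s t
  let Ψ : Fin n → Set (BondConfig V) := fun i => ⋂ t ∈ Tf i, openConnIn V₂ a t
  have hTn' : ∀ i, ∀ t ∈ Tn' i, t ∈ V₁ := by
    intro i t ht
    by_cases hne : (Tf i).Nonempty
    · simp only [Tn', if_pos hne, mem_insert] at ht
      rcases ht with rfl | ht
      · exact ha₁
      · exact (mem_filter.1 ht).2
    · simp only [Tn', if_neg hne] at ht
      exact (mem_filter.1 ht).2
  have hTf : ∀ i, ∀ t ∈ Tf i, t ∈ V₂ := by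
    intro i t ht
    obtain ⟨htT, htV⟩ := mem_filter.1 ht
    rcases hT i t htT with h | h
    · exact absurd h htV
    · exact h
  -- (1) on positive-weight configurations the events agree with their factored forms
  have hagree : ∀ ω : BondConfig V, bernoulliWeight w ω ≠ 0 → ∀ i,
      (ω ∈ (⋂ t ∈ T i, (openConnIn (V₁ ∪ V₂) s t : Set (BondConfig V))) ↔ ω ∈ Φ i ∩ Ψ i) := by
    intro ω hωw i
    have hω : ∀ x y : V, x ∈ V₁ → y ∈ V₂ → x ≠ a → y ≠ a → s(x, y) ∉ ω :=
      fun x y hx hy hxa hya hmem =>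
        hωw (IncStarCycle.bernoulliWeight_eq_zero_of_mem w hmem (hw x y hx hy hxa hya))
    have hL := fun t (ht : t ∈ V₁) =>
      IncStarCutVertex.openConnIn_union_iff_of_mem_left hV ha₁ ha₂ hω hs ht (s := s) (t := t)
    have hR := fun t (ht : t ∈ V₂) =>
      IncStarCutVertex.openConnIn_union_iff_of_mem_right hV ha₁ ha₂ hω hs ht (s := s) (t := t)
    simp only [Set.mem_inter_iff, Set.mem_iInter, Φ, Ψ]
    constructor
    · intro h
      refine ⟨fun t ht => ?_, fun t ht => ((hR t (hTf i t ht)).1 (h t (mem_filter.1 ht).1)).2⟩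
      by_cases hne : (Tf i).Nonempty
      · simp only [Tn', if_pos hne, mem_insert] at ht
        rcases ht with rfl | ht
        · obtain ⟨u, hu⟩ := hne
          exact ((hR u (hTf i u hu)).1 (h u (mem_filter.1 hu).1)).1
        · exact (hL t (mem_filter.1 ht).2).1 (h t (mem_filter.1 ht).1)
      · simp only [Tn', if_neg hne] at ht
        exact (hL t (mem_filter.1 ht).2).1 (h t (mem_filter.1 ht).1)
    · rintro ⟨hΦ, hΨ⟩ t ht
      by_cases htV : t ∈ V₁
      · have htn : t ∈ Tn' i := by
          by_cases hne : (Tf i).Nonempty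
          · simp only [Tn', if_pos hne, mem_insert]
            exact Or.inr (mem_filter.2 ⟨ht, htV⟩)
          · simp only [Tn', if_neg hne]
            exact mem_filter.2 ⟨ht, htV⟩
        exact (hL t htV).2 (hΦ t htn)
      · have htf : t ∈ Tf i := mem_filter.2 ⟨ht, htV⟩
        have hne : (Tf i).Nonempty := ⟨t, htf⟩
        have han : a ∈ Tn' i := by simp only [Tn', if_pos hne]; exact mem_insert_self _ _
        exact (hR t (hTf i t htf)).2 ⟨hΦ a han, hΨ t htf⟩
  -- (2) hence the two `E_n` agree
  have hmom : sahiE (bernoulliWeight w) n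
      (fun i => ind (⋂ t ∈ T i, (openConnIn (V₁ ∪ V₂) s t : Set (BondConfig V)))) =
      sahiE (bernoulliWeight w) n (fun i => ind (Φ i) * ind (Ψ i)) := by
    refine TwoChainUnions.sahiE_congr_of_prodMoments (bernoulliWeight w) (bernoulliWeight w) n _ _
      fun S => ?_
    rw [ex_def, ex_def]
    refine Finset.sum_congr rfl fun ω _ => ?_
    by_cases hωw : bernoulliWeight w ω = 0
    · rw [hωw, zero_mul, zero_mul]
    · congr 1
      rw [Finset.prod_apply, Finset.prod_apply]
      refine Finset.prod_congr rfl fun i _ => ?_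
      rw [Pi.mul_apply, ← BHK2006.ind_inter]
      by_cases h : ω ∈ (⋂ t ∈ T i, (openConnIn (V₁ ∪ V₂) s t : Set (BondConfig V)))
      · rw [ind_of_mem h, ind_of_mem ((hagree ω hωw i).1 h)]
      · rw [ind_of_not_mem h, ind_of_not_mem (fun h' => h ((hagree ω hωw i).2 h'))]
  rw [hmom]
  -- (3) coordinates: off-diagonal pairs inside `V₁`
  set F : Finset (Sym2 V) := Finset.univ.filter fun z : Sym2 V => ¬ z.IsDiag ∧ ∀ v ∈ z, v ∈ V₁ with hF
  have hFcoe : (↑F : Set (Sym2 V)) = {z : Sym2 V | ¬ z.IsDiag ∧ ∀ v ∈ z, v ∈ V₁} := by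
    ext z; simp [hF]
  have hdet₁ : ∀ x : V, DeterminedBy (openConnIn V₁ s x : Set (BondConfig V)) (↑F : Set (Sym2 V)) := by
    intro x; rw [hFcoe]; exact IncStarCutVertex.determinedBy_openConnIn_offDiag V₁ s x
  have hdet₂ : ∀ x : V, DeterminedBy (openConnIn V₂ a x : Set (BondConfig V)) (↑F : Set (Sym2 V))ᶜ := by
    intro x
    refine (IncStarCutVertex.determinedBy_openConnIn_offDiag V₂ a x).mono fun z hz hzF => ?_
    rw [hFcoe] at hzF
    obtain ⟨hnd, hz₂⟩ := hz
    obtain ⟨-, hz₁⟩ := hzF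
    revert hnd hz₁ hz₂
    refine Sym2.inductionOn z fun u v => ?_
    intro hnd hz₂ hz₁
    have hu : u = a := hV u (hz₁ u (Sym2.mem_mk_left u v)) (hz₂ u (Sym2.mem_mk_left u v))
    have hv : v = a := hV v (hz₁ v (Sym2.mem_mk_right u v)) (hz₂ v (Sym2.mem_mk_right u v))
    exact hnd (by rw [Sym2.mk_isDiag_iff, hu, hv])
  have hdetΦ : ∀ S : Finset (Fin n), DeterminedBy (⋂ i ∈ S, Φ i) (↑F : Set (Sym2 V)) :=
    fun S => determinedBy_biInter S Φ fun i _ => determinedBy_biInter (Tn' i) _ fun t _ => hdet₁ t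
  have hdetΨ : ∀ S : Finset (Fin n), DeterminedBy (⋂ i ∈ S, Ψ i) (↑F : Set (Sym2 V))ᶜ :=
    fun S => determinedBy_biInter S Ψ fun i _ => determinedBy_biInter (Tf i) _ fun t _ => hdet₂ t
  have hm : ∀ X : Set (BondConfig V), MeasurableSet X := fun _ => MeasurableSet.of_discrete
  -- (4) the independent product formula
  refine SahiIndependentProducts.sahiE_mul_nonneg_of_indepMoments (bernoulliWeight w)
    (sum_bernoulliWeight w) (fun i => ind (Φ i)) (fun i => ind (Ψ i)) ?_ ?_ ?_
  · -- mixed moments factor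
    intro S
    rw [IncStarCycle.prod_ind_eq_ind_iInter, IncStarCycle.prod_ind_eq_ind_iInter, ex_ind_mul_ind,
      ex_bernoulliWeight_ind, ex_bernoulliWeight_ind]
    exact prodBernoulli_real_inter_of_determinedBy w F (hdetΦ S) (hdetΨ S) (hm _) (hm _)
  · -- sub-families of the far factors: principal events of `(V₂, a)`
    intro m ι
    exact h₂ m (fun j => Tf (ι j)) fun j t ht => hTf (ι j) t ht
  · -- block products of the near factors: principal events of `(V₁, s)`
    intro m B
    have hB : (fun j => ∏ i ∈ B j, ind (Φ i)) =
        fun j => ind (⋂ t ∈ (B j).biUnion Tn', (openConnIn V₁ s t : Set (BondConfig V))) := by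
      funext j
      rw [IncStarCycle.prod_ind_eq_ind_iInter, Finset.set_biInter_biUnion]
    rw [hB]
    refine h₁ m (fun j => (B j).biUnion Tn') fun j t ht => ?_
    obtain ⟨i, -, hi⟩ := mem_biUnion.1 ht
    exact hTn' i t hi

/-- **Absolute form.**  If `V₁ ∪ V₂` is everything, the conclusion is about the plain cluster events
`{C_s ⊇ T} = ⋂_{t∈T} {s ↔ t}`. [this work] -/
theorem sahiE_principal_of_cutVertex_univ (w : Sym2 V → unitInterval) {V₁ V₂ : Set V} {a s : V}
    (hV : ∀ x, x ∈ V₁ → x ∈ V₂ → x = a) (ha₁ : a ∈ V₁) (ha₂ : a ∈ V₂) (hs : s ∈ V₁)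
    (huniv : ∀ x, x ∈ V₁ ∪ V₂)
    (hw : ∀ x y : V, x ∈ V₁ → y ∈ V₂ → x ≠ a → y ≠ a → w s(x, y) = 0)
    (h₁ : ∀ (m : ℕ) (T : Fin m → Finset V), (∀ j, ∀ t ∈ T j, t ∈ V₁) →
      0 ≤ sahiE (bernoulliWeight w) m (fun j => ind (⋂ t ∈ T j, (openConnIn V₁ s t : Set (BondConfig V)))))
    (h₂ : ∀ (m : ℕ) (T : Fin m → Finset V), (∀ j, ∀ t ∈ T j, t ∈ V₂) →
      0 ≤ sahiE (bernoulliWeight w) m (fun j => ind (⋂ t ∈ T j, (openConnIn V₂ a t : Set (BondConfig V)))))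
    {n : ℕ} (T : Fin n → Finset V) :
    0 ≤ sahiE (bernoulliWeight w) n (fun i => ind (⋂ t ∈ T i, (openConn s t : Set (BondConfig V)))) := by
  have hU : V₁ ∪ V₂ = Set.univ := Set.eq_univ_of_forall huniv
  have hev : ∀ t : V, (openConn s t : Set (BondConfig V)) = openConnIn (V₁ ∪ V₂) s t := by
    intro t; rw [hU]; ext ω; exact BlockExploration.mem_openConn_iff_openConnIn_univ
  simp only [hev]
  exact sahiE_principal_of_cutVertex w hV ha₁ ha₂ hs hw h₁ h₂ T fun i t _ => huniv t

end SahiPrincipalCutVertex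

end Summit.CriticalPhenomena.PercolationContinuityZ3.Theorems
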